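import Summits.QuantumFields.BalabanUV.Beta.FP.BiLaplaceBlockResponse

/-!
# `BalabanUV.Beta.FP.BiLaplaceResponseIsMultiplier` — road «FP» for binder row D1, DESIGN ROW **GHOST-STEP**, brick (g1″) (owner d1-p3 gen 13,
# `N2B-DESIGN.md` v1.3 §6): **THE BLOCK-SUM RESPONSE KERNEL IS (MINUS THE TRANSPOSE OF) an2's MULTIPLIER KERNEL** — `Hb_N(x′, y₀) = −Wb_N(y₀, x′)` —
# and the multiplier-response kernel is symmetric, `HWb_N(y, y₀) = HWb_N(y₀, y)`; hence the two-level difference of the bi-Laplacian block Green columns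
# reads `Sb_{N′}(x, x′) − Sb_M(x, x′) = −Σ'_y blockSum_M(Sb_{N′}(·, x′))(y) · Wb_M(y, x)` IN an2's OBJECTS ONLY (every `d`, `N′ = M·L`); UNCONDITIONAL

HONEST DEPENDENCY (page 1, mandatory): continuum YM on T⁴ ⇐ BetaPertH ∧ nine spine estimates (0/9 proved); BetaPertH ⇐ (D1) ∧ (D4) ∧ CAP+tail;
G-an2-4 gates asym, D1 and NE2/3/4.  HONEST FRAMING (cell contract, verbatim): «discharging `BetaPertH` makes Bałaban's UV stability UNCONDITIONAL —
a real constructive-QFT result; it is NOT the continuum limit and NOT the Clay problem.»  THIS MODULE is [folklore]-grade bookkeeping (the symmetry of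
the inverse of a symmetric KKT operator, done by two summations by parts on `ℤ^{d+1}` with an2's bounded∕summable column letters) over an2-g6's
`BiLaplaceBlockKKT` ∕ `BiLaplaceBlockGreen` (`Sb`, `Wb`, `SbCol`, `WbAdj`, `lapLapN_SbCol`, `Sb_eq_lip0`'s method) and the owner's `BiLaplaceBlockResponse`
(`Hb`, `HWb`) p280915 ✓; no `def`, no `def … : Prop`, nothing cited, 0 sorry.  0∕4 row-D1 binders; NOT SDF, NOT D1, NOT BetaPertH, NOT continuum, NOT Clay.
«not in print; our bookkeeping».

ABSOLUTE RULE (cell charter, verbatim): «No internally-minted statement may enter as a cited fact. Every hypothesis is either kernel-proved in this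
package or a verbatim quotation of a PUBLISHED theorem with page reference. The manuscript(s) under audit are NOT citable for their own disputed
steps — they are the thing under adjudication; programme-internal (2001/route/tribunal) claims are never citable.»

WHY (memo `N2B-DESIGN.md` v1.3 §6, GHOST-STEP (g1)∕(g3)): p280915 introduced the response kernel `Hb` (force-free solution of an2's block-constrained
squared-Laplacian system with unit block-sum datum) and proved `SbCol_{N′} − SbCol_M = Σ' blockSum_M(SbCol_{N′}) · Hb_M`.  The KKT operator
`(λ, ω) ↦ (L(Lλ) − ω∘quo, blockSum λ)` is symmetric after the sign flip of its constraint row, so its tempered inverse is symmetric: the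
datum-to-field block (`Hb`) is minus the transpose of the force-to-multiplier block (`Wb`), and the datum-to-multiplier block (`HWb`) is symmetric.
CONSEQUENCE: no new limit object is needed for (g3) «(CONV-C)-Sb» beyond an2's `Sb` and `Wb` (gan24-p3-g28's row), and the gauge-multiplier two-level
defect (`GamM = −dz SbCol`, p275731) is expressed through `Wb_M` alone.

CONTENT (generic `d`, `[NeZero N]`; every identity UNCONDITIONAL):
* §1 letters: the response column `z ↦ Hb z y₀` is bounded and summable, and so is its Laplacian (from p280915's `hB_bdd_summable`).
* §2 `lip0_blockConst_eq` (a bounded block-constant observable pairs with a summable field through its block sums), the two evaluations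
  `lip0_HbCol_WbAdj = Wb y₀ x′`, `lip0_HbCol_δS = Hb x′ y₀`, the summation-by-parts symmetry `lip0_lapLap_symm`, and the vanishing `lip0_SbCol_lapLap_HbCol = 0`.
* §3 **`Hb_eq_neg_Wb : Hb x′ y₀ = −Wb y₀ x′`**, **`HWb_symm`**, `solvesB_neg_Wb` (the transpose of `Wb` solves the response system), and the headline
  restated in an2's objects **`SbCol_sub_eq_neg_tsum_Wb (hN : N′ = M·L)`**.
Provenance: road «FP» OWNER, unit b2b-balaban-beta-d1-p3 gen 13 (prover-b2b-balaban-beta-d1-p3-g13-0), 2026-08-21; no existing file touched.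
-/

noncomputable section

namespace Summit.QuantumFields.BalabanUV.Beta.FP.BiLaplaceResponseIsMultiplier

open Literature.MathematicalPhysics.QuantumFieldTheory
open Literature.MathematicalPhysics.QuantumFieldTheory.Balaban1983to89
open Literature.MathematicalPhysics.QuantumFieldTheory.Balaban1983to89.Beta
open AffineAveraging (Form0 Form1 dz codiff₁ box toSite blockSum)
open AffineReproduction (IsBlockConst)
open LatticeForm (quo)
open KKTFluctuationUnique (Tempered0 Tempered0.of_bounded abs_le_of_decay510)
open KKTFluctuationEnergy (lip0 lip1 summable_mul_of_bdd summable_mul_of_bdd' summable_shift_sub summable_dz summable_codiff₁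
  abs_dz_le abs_codiff₁_le lip0_codiff₁ tsum_blocks tsum_mul_eq_zero_of_blockConst quo_zsmul_add_toSite)
open ScalarBlockGreen (lip0_comm lip1_comm lip0_add δS)
open ResolventComposition (quo_zsmul')
open BiLaplaceBlockKKT (Sb Wb)
open BiLaplaceBlockGreen (SbCol WbAdj SolvesB lapLapN_SbCol blockSum_SbCol SbCol_bdd_summable lapN_SbCol_bdd_summable
  WbAdj_bdd isBlockConst_WbAdj)
open BiLaplaceBlockResponse (hB Hb HWb hWB Hb_EL Hb_M hB_bdd_summable decay_hWB solvesB_Hb SbCol_sub_eq_tsum_Hb)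

variable {d : ℕ} {N : ℕ} [NeZero N]

/-! ## §1 Letters of the response column -/

/-- [folklore] The response columns `z ↦ Hb z y₀` are uniformly bounded and summable. -/
theorem HbCol_bdd_summable : ∃ C : ℝ, 0 ≤ C ∧ (∀ (y₀ z : AffineAveraging.Site (d + 1)), |Hb (N := N) z y₀| ≤ C)
    ∧ ∀ (y₀ : AffineAveraging.Site (d + 1)), Summable (fun z => Hb (N := N) z y₀) := by
  obtain ⟨C, hC, hb, hs⟩ := hB_bdd_summable (N := N) (d := d)
  exact ⟨C, hC, fun y₀ z => hb _, fun y₀ => summable_shift_sub hs ((N : ℤ) • y₀)⟩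

/-- [folklore] The Laplacians of the response columns are uniformly bounded and summable. -/
theorem lapN_HbCol_bdd_summable : ∃ C : ℝ, 0 ≤ C ∧
    (∀ (y₀ z : AffineAveraging.Site (d + 1)), |codiff₁ (dz (fun z => Hb (N := N) z y₀)) z| ≤ C)
    ∧ ∀ (y₀ : AffineAveraging.Site (d + 1)), Summable (codiff₁ (dz (fun z => Hb (N := N) z y₀))) := by
  obtain ⟨C, hC, hbdd, hsum⟩ := HbCol_bdd_summable (N := N) (d := d)
  refine ⟨(d + 1 : ℕ) * (2 * (2 * C)), by positivity, fun y₀ z => ?_,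
    fun y₀ => summable_codiff₁ (fun κ => summable_dz (hsum y₀) κ)⟩
  exact abs_codiff₁_le (fun κ w => abs_dz_le (hbdd y₀) κ w) z

/-! ## §2 The four pairings -/

/-- [folklore] A bounded block-constant observable pairs with a summable field through the field's block sums. -/
theorem lip0_blockConst_eq {g μ : Form0 (d + 1) ℝ} {B : ℝ} (hg : ∀ x, |g x| ≤ B) (hgc : IsBlockConst N g) (hμ : Summable μ) :
    ∑' x, μ x * g x = ∑' y, blockSum N μ y * g ((N : ℤ) • y) := by
  rw [tsum_blocks (N := N) (summable_mul_of_bdd' hμ hg)]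
  refine tsum_congr fun y => ?_
  calc ∑ b ∈ box (d + 1) N, μ ((N : ℤ) • y + toSite b) * g ((N : ℤ) • y + toSite b)
      = ∑ b ∈ box (d + 1) N, μ ((N : ℤ) • y + toSite b) * g ((N : ℤ) • y) :=
        Finset.sum_congr rfl fun b hb => by rw [hgc y b hb]
    _ = blockSum N μ y * g ((N : ℤ) • y) := by rw [blockSum, Finset.sum_mul]

/-- [our proof] The response column pairs with the pulled-back multiplier of the Green column to the multiplier entry:
`⟨Hb(·, y₀), Wb(quo ·, x′)⟩ = Wb(y₀, x′)` (unit block-sum datum at `y₀`). -/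
theorem lip0_HbCol_WbAdj (x' y₀ : AffineAveraging.Site (d + 1)) :
    lip0 (fun z => Hb (N := N) z y₀) (WbAdj (N := N) x') = Wb (N := N) y₀ x' := by
  obtain ⟨C, _, _, hsum⟩ := HbCol_bdd_summable (N := N) (d := d)
  obtain ⟨CW, _, hW⟩ := WbAdj_bdd (N := N) (d := d)
  unfold lip0
  rw [lip0_blockConst_eq (N := N) (hW x') (isBlockConst_WbAdj (N := N) x') (hsum y₀)]
  have e : ∀ y, blockSum N (fun z => Hb (N := N) z y₀) y * WbAdj (N := N) x' ((N : ℤ) • y)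
      = if y = y₀ then Wb (N := N) y₀ x' else 0 := by
    intro y
    rw [Hb_M]
    by_cases hy : y = y₀
    · subst hy
      rw [if_pos rfl, if_pos rfl, one_mul, WbAdj, quo_zsmul']
    · rw [if_neg hy, if_neg hy, zero_mul]
  rw [tsum_congr e, tsum_eq_single y₀ (fun y hy => if_neg hy), if_pos rfl]

/-- [folklore] The response column pairs with the point source to its own entry: `⟨Hb(·, y₀), δ_{x′}⟩ = Hb(x′, y₀)`. -/
theorem lip0_HbCol_δS (x' y₀ : AffineAveraging.Site (d + 1)) :
    lip0 (fun z => Hb (N := N) z y₀) (δS x') = Hb (N := N) x' y₀ := by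
  unfold lip0
  have e : ∀ z, Hb (N := N) z y₀ * δS x' z = if z = x' then Hb (N := N) x' y₀ else 0 := by
    intro z
    by_cases hz : z = x'
    · subst hz
      simp [δS]
    · simp [δS, hz]
  rw [tsum_congr e, tsum_eq_single x' (fun z hz => if_neg hz), if_pos rfl]

/-- [folklore] **SUMMATION BY PARTS, TWICE**: for bounded summable fields with bounded summable Laplacians,
`⟨f, L(L g)⟩ = ⟨g, L(L f)⟩` (`L = codiff₁ ∘ dz`). -/
theorem lip0_lapLap_symm {f g : Form0 (d + 1) ℝ} {Bf Bg Cf Cg : ℝ}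
    (hf : ∀ x, |f x| ≤ Bf) (hfs : Summable f) (hLf : ∀ x, |codiff₁ (dz f) x| ≤ Cf) (hLfs : Summable (codiff₁ (dz f)))
    (hg : ∀ x, |g x| ≤ Bg) (hgs : Summable g) (hLg : ∀ x, |codiff₁ (dz g) x| ≤ Cg) (hLgs : Summable (codiff₁ (dz g))) :
    lip0 f (codiff₁ (dz (codiff₁ (dz g)))) = lip0 g (codiff₁ (dz (codiff₁ (dz f)))) := by
  rw [lip0_codiff₁ hf (fun κ => summable_dz hLgs κ), lip1_comm, ← lip0_codiff₁ hLg (fun κ => summable_dz hfs κ),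
    lip0_comm (codiff₁ (dz g)) (codiff₁ (dz f)), lip0_codiff₁ hLf (fun κ => summable_dz hgs κ), lip1_comm,
    ← lip0_codiff₁ hg (fun κ => summable_dz hLfs κ)]

/-- [our proof] The Green column pairs to zero with the bi-Laplacian of the response column (its block sums vanish, and `L(L Hb)` is the
block-constant multiplier `HWb ∘ quo`). -/
theorem lip0_SbCol_lapLap_HbCol (x' y₀ : AffineAveraging.Site (d + 1)) :
    lip0 (SbCol (N := N) x') (codiff₁ (dz (codiff₁ (dz (fun z => Hb (N := N) z y₀))))) = 0 := by
  have hfun : codiff₁ (dz (codiff₁ (dz (fun z => Hb (N := N) z y₀)))) = fun z => HWb (N := N) (quo N z) y₀ :=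
    funext (Hb_EL (N := N) y₀)
  obtain ⟨C, _, _, hsum⟩ := SbCol_bdd_summable (N := N) (d := d)
  obtain ⟨δ, CW, hδ, _, hW⟩ := decay_hWB (N := N) (d := d)
  rw [hfun, lip0_comm]
  unfold lip0
  refine tsum_mul_eq_zero_of_blockConst (N := N) (M := CW) (fun z => abs_le_of_decay510 hδ hW _) ?_ (hsum x')
    (blockSum_SbCol (N := N) x')
  intro y b hb
  simp only
  rw [quo_zsmul_add_toSite y hb, quo_zsmul']

/-! ## §3 The response kernel is minus the transposed multiplier kernel -/

/-- [our proof] **`Hb = −Wbᵀ`**: the block-sum response kernel of an2's block-constrained squared-Laplacian system is minus the transpose of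
an2's multiplier kernel: `Hb_N(x′, y₀) = −Wb_N(y₀, x′)`.  Proof: pair (EL_b) of the Green column `SbCol x′` (`L(L S) = Wb(quo ·, x′) + δ_{x′}`)
with the response column `Hb(·, y₀)` and use the summation-by-parts symmetry against `⟨S_{x′}, L(L Hb_{y₀})⟩ = 0`. -/
theorem Hb_eq_neg_Wb (x' y₀ : AffineAveraging.Site (d + 1)) :
    Hb (N := N) x' y₀ = -Wb (N := N) y₀ x' := by
  obtain ⟨CH, _, hHb, hHs⟩ := HbCol_bdd_summable (N := N) (d := d)
  obtain ⟨CLH, _, hLHb, hLHs⟩ := lapN_HbCol_bdd_summable (N := N) (d := d)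
  obtain ⟨CS, _, hSb, hSs⟩ := SbCol_bdd_summable (N := N) (d := d)
  obtain ⟨CL, _, hLSb, hLSs⟩ := lapN_SbCol_bdd_summable (N := N) (d := d)
  obtain ⟨CW, _, hW⟩ := WbAdj_bdd (N := N) (d := d)
  have hA := lip0_lapLap_symm (hHb y₀) (hHs y₀) (hLHb y₀) (hLHs y₀) (hSb x') (hSs x') (hLSb x') (hLSs x')
  have hB := lip0_SbCol_lapLap_HbCol (N := N) x' y₀
  have s1 : Summable (fun z => Hb (N := N) z y₀ * WbAdj (N := N) x' z) := summable_mul_of_bdd' (hHs y₀) (hW x')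
  have s2 : Summable (fun z => Hb (N := N) z y₀ * δS x' z) :=
    summable_mul_of_bdd' (M := 1) (hHs y₀) (fun z => by
      unfold δS
      split_ifs <;> simp)
  have hC : lip0 (fun z => Hb (N := N) z y₀) (codiff₁ (dz (codiff₁ (dz (SbCol (N := N) x')))))
      = Wb (N := N) y₀ x' + Hb (N := N) x' y₀ := by
    rw [lapLapN_SbCol, lip0_add s1 s2, lip0_HbCol_WbAdj, lip0_HbCol_δS]
  linarith [hA, hB, hC]

/-- [our proof] Equivalently `Wb_N(y₀, x′) = −Hb_N(x′, y₀)`: an2's multiplier kernel, as a function of the SOURCE point, is (minus) the response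
column. -/
theorem Wb_eq_neg_Hb (y₀ x' : AffineAveraging.Site (d + 1)) :
    Wb (N := N) y₀ x' = -Hb (N := N) x' y₀ := by
  rw [Hb_eq_neg_Wb, neg_neg]

/-- [our proof] **THE TRANSPOSED MULTIPLIER KERNEL SOLVES THE RESPONSE SYSTEM**: `z ↦ −Wb(y₀, z)` is the force-free solution of an2's system with
unit block-sum datum at `y₀` (multiplier `HWb(·, y₀)`). -/
theorem solvesB_neg_Wb (y₀ : AffineAveraging.Site (d + 1)) :
    SolvesB N 0 (fun y => if y = y₀ then (1 : ℝ) else 0) (fun z => -Wb (N := N) y₀ z) (fun y => HWb (N := N) y y₀) := by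
  have h : (fun z => -Wb (N := N) y₀ z) = fun z => Hb (N := N) z y₀ := funext fun z => (Hb_eq_neg_Wb (N := N) z y₀).symm
  rw [h]
  exact solvesB_Hb (N := N) y₀

/-- [our proof] **THE MULTIPLIER-RESPONSE KERNEL IS SYMMETRIC**: `HWb_N(y₁, y₀) = HWb_N(y₀, y₁)` (pair (EL_b) of `Hb(·, y₁)` with `Hb(·, y₀)`
and use the summation-by-parts symmetry). -/
theorem HWb_symm (y₀ y₁ : AffineAveraging.Site (d + 1)) :
    HWb (N := N) y₁ y₀ = HWb (N := N) y₀ y₁ := by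
  obtain ⟨CH, _, hHb, hHs⟩ := HbCol_bdd_summable (N := N) (d := d)
  obtain ⟨CLH, _, hLHb, hLHs⟩ := lapN_HbCol_bdd_summable (N := N) (d := d)
  obtain ⟨δ, CW, hδ, _, hW⟩ := decay_hWB (N := N) (d := d)
  -- `⟨Hb_{a}, L(L Hb_{b})⟩ = HWb(a, b)`
  have pair : ∀ a b : AffineAveraging.Site (d + 1),
      lip0 (fun z => Hb (N := N) z a) (codiff₁ (dz (codiff₁ (dz (fun z => Hb (N := N) z b))))) = HWb (N := N) a b := by
    intro a b
    have hfun : codiff₁ (dz (codiff₁ (dz (fun z => Hb (N := N) z b)))) = fun z => HWb (N := N) (quo N z) b :=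
      funext (Hb_EL (N := N) b)
    rw [hfun]
    unfold lip0
    show ∑' x, Hb (N := N) x a * HWb (N := N) (quo N x) b = HWb (N := N) a b
    rw [lip0_blockConst_eq (N := N) (g := fun z => HWb (N := N) (quo N z) b) (μ := fun z => Hb (N := N) z a) (B := CW)
      (fun z => abs_le_of_decay510 hδ hW (quo N z - b)) ?_ (hHs a)]
    · have e : ∀ y, blockSum N (fun z => Hb (N := N) z a) y * HWb (N := N) (quo N ((N : ℤ) • y)) b
          = if y = a then HWb (N := N) a b else 0 := by
        intro y
        rw [Hb_M, quo_zsmul']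
        by_cases hy : y = a
        · subst hy
          rw [if_pos rfl, if_pos rfl, one_mul]
        · rw [if_neg hy, if_neg hy, zero_mul]
      rw [tsum_congr e, tsum_eq_single a (fun y hy => if_neg hy), if_pos rfl]
    · intro y bb hb
      simp only
      rw [quo_zsmul_add_toSite y hb, quo_zsmul']
  rw [← pair y₁ y₀, ← pair y₀ y₁]
  exact lip0_lapLap_symm (hHb y₁) (hHs y₁) (hLHb y₁) (hLHs y₁) (hHb y₀) (hHs y₀) (hLHb y₀) (hLHs y₀)

/-- [our proof] **THE TWO-LEVEL DIFFERENCE OF THE GREEN COLUMNS IN an2's OBJECTS ONLY** (`N′ = M·L`):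
`Sb_{N′}(x, x′) − Sb_M(x, x′) = −Σ'_y blockSum_M(Sb_{N′}(·, x′))(y) · Wb_M(y, x)` — p280915's response form with `Hb_M = −Wb_Mᵀ`. -/
theorem SbCol_sub_eq_neg_tsum_Wb {N' M L : ℕ} [NeZero N'] [NeZero M] [NeZero L] (hN : N' = M * L)
    (x' x : AffineAveraging.Site (d + 1)) :
    SbCol (N := N') x' x - SbCol (N := M) x' x
      = -∑' y, blockSum M (SbCol (N := N') x') y * Wb (N := M) y x := by
  rw [SbCol_sub_eq_tsum_Hb hN, ← tsum_neg]
  refine tsum_congr fun y => ?_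
  rw [Hb_eq_neg_Wb, mul_neg]

end Summit.QuantumFields.BalabanUV.Beta.FP.BiLaplaceResponseIsMultiplier

end
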